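import Summits.NavierStokesRegularity.NavierStokesRegularity.Theorems.TerminalTraceTypeITraceScarL3ApexPackageTranslate
import Literature.Analysis.FluidPDE.LocalTypeI
import HarnessLib

/-!
# The LOUD-SURVIVOR portrait, kernel: the top singular set of an extinct Type-I apex is closed, and under
# quiet-shell exclusion it meets every thick shell around each of its points (uniformly perfect, unbounded)
# (item `TerminalTrace.TypeITraceScarL3`, stmt-NavierStokesRegularity-18385; ROUND-26 §3a (S1)–(S2))

Seat ns-typeII-p3 g10 (cell ns-regularity-ideate), `--supports stmt-NavierStokesRegularity-18385` (helper).
Line `annulus-dichotomy` (skeleton v3, sha16 a0af4d6cb8b072dd) cuts Stub C into QUIET-SHELL exclusion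
(`stub_no_quietShellExtinctApex`: an extinct Type-I apex of class `(M, D₀, C)` essentially bounded on one
shell slab `]−δ,0[ × {R < |y| < A₀R}` is not backward singular at the origin) and LOUD-DUST exclusion
(`stub_no_loudShellExtinctApex`, OPEN — the residual hard core).  This file records what a LOUD survivor
must look like (nsreg-p2 g28, ROUND-26 §3a), for the disprover and the loud-dust prover:

* §2 `isClosed_topSingularSet` — the top singular set `Σ₀(U) = {x | (0, x) backward singular}` is CLOSED
  (backward regularity is an open condition: `Q_{r/2}((0,y)) ⊆ Q_r((0,x))`);
  `quietShell_of_forall_not_isBackwardSingularPoint` — if every point of a closed shell `{R ≤ |y| ≤ A₀R}`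
  is backward regular at the top, `U` has a QUIET SHELL of ratio `A₀` (the clause `QA(U, A₀)` verbatim):
  finitely many bounded backward cylinders cover the compact shell, a Lebesgue thickening of the shell
  lies in their union and contains the open shell of radius `R' = max(R − η/2, R/2)`.
* §3 (S2) `exists_topSingular_mem_shell_of_quietShellExclusion` — if `A₀ > 1` is a quiet-shell-excluding
  ratio for the class (the hypothesis `hQA` of `stub_no_loudShellExtinctApex`, VERBATIM) and `(U, P, G)`
  carries the package, then around EVERY top singular point `x`, at EVERY radius `R > 0`, the closed shell
  `{R ≤ |y − x| ≤ A₀R}` contains another top singular point (else the translate `U(·, · + x)` — which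
  carries the package by `apexPackage_translate` — has a quiet shell, and `hQA` makes `(0, x)` regular);
  hence (`exists_topSingular_norm_ge_of_quietShellExclusion`) the top singular set of a backward-singular
  loud survivor is UNBOUNDED: the «closed, unbounded, A₀-uniformly perfect dust» of ROUND-26 §3a, whose
  `ℋ¹`-measure is zero by `hausdorffMeasure_topSingular_apex_eq_zero` (p588528).

WHAT THIS IS NOT: not Stub QA, not Stub LOUD, not NS regularity — survivor geometry inside the extinct
Type-I apex class, conditional on the displayed quiet-shell-exclusion hypothesis where it appears.
[folklore; Tao 2019 arXiv:1908.04958 §5 (shell of regularity); CaffarelliKohnNirenberg1982 §6]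
-/

noncomputable section

set_option linter.dupNamespace false

namespace Summit.NavierStokesRegularity.NavierStokesRegularity.Theorems.TypeITraceScarL3

open MeasureTheory Set Function Filter Topology Metric
open Literature.Analysis.FluidPDE
open scoped NNReal ENNReal InnerProductSpace RealInnerProductSpace

/-! ### §2 The top singular set is closed; regularity on a closed shell gives a quiet shell -/

section TopSingular

variable {U : ℝ → EuclideanSpace ℝ (Fin 3) → EuclideanSpace ℝ (Fin 3)}

/-- **Backward regularity at the top is an open condition**: if `(0, x)` is not backward singular, with
`U ∈ L^∞(Q_r((0, x)))`, then no `(0, y)` with `|y − x| < r/2` is backward singular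
(`Q_{r/2}((0, y)) ⊆ Q_r((0, x))`). [folklore; CaffarelliKohnNirenberg1982 §6 (regular points form an open set)] -/
theorem not_isBackwardSingularPoint_of_near {x y : EuclideanSpace ℝ (Fin 3)} {r : ℝ} (hr : 0 < r)
    (hfin : eLpNorm (uncurry U) ∞
      (volume.restrict (parabolicCylinder r (((0 : ℝ), x) : ℝ × EuclideanSpace ℝ (Fin 3)))) ≠ ∞)
    (hy : dist y x < r / 2) :
    ¬ IsBackwardSingularPoint U ((0 : ℝ), y) := by
  intro hsing
  have hsub : parabolicCylinder (r / 2) (((0 : ℝ), y) : ℝ × EuclideanSpace ℝ (Fin 3)) ⊆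
      parabolicCylinder r (((0 : ℝ), x) : ℝ × EuclideanSpace ℝ (Fin 3)) := by
    rintro ⟨s, w⟩ hw
    rw [mem_parabolicCylinder] at hw ⊢
    obtain ⟨⟨hs1, hs2⟩, hw⟩ := hw
    refine ⟨⟨by nlinarith, hs2⟩, ?_⟩
    calc dist w x ≤ dist w y + dist y x := dist_triangle _ _ _
      _ < r / 2 + r / 2 := add_lt_add hw hy
      _ = r := by ring
  have hle : eLpNorm (uncurry U) ∞
      (volume.restrict (parabolicCylinder (r / 2) (((0 : ℝ), y) : ℝ × EuclideanSpace ℝ (Fin 3)))) ≤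
      eLpNorm (uncurry U) ∞
        (volume.restrict (parabolicCylinder r (((0 : ℝ), x) : ℝ × EuclideanSpace ℝ (Fin 3)))) :=
    eLpNorm_mono_measure _ (Measure.restrict_mono hsub le_rfl)
  rw [hsing (r / 2) (half_pos hr)] at hle
  exact hfin (top_le_iff.1 hle)

/-- **The top singular set `Σ₀(U) = {x | (0, x) backward singular}` is CLOSED** (ROUND-26 §3a (S1)).
[folklore; CaffarelliKohnNirenberg1982 §6] -/
theorem isClosed_topSingularSet (U : ℝ → EuclideanSpace ℝ (Fin 3) → EuclideanSpace ℝ (Fin 3)) :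
    IsClosed {x : EuclideanSpace ℝ (Fin 3) | IsBackwardSingularPoint U ((0 : ℝ), x)} := by
  rw [← isOpen_compl_iff, Metric.isOpen_iff]
  intro x hx
  have hx' : ¬ IsBackwardSingularPoint U ((0 : ℝ), x) := hx
  simp only [IsBackwardSingularPoint, not_forall] at hx'
  obtain ⟨r, hr, hfin⟩ := hx'
  refine ⟨r / 2, half_pos hr, fun y hy => ?_⟩
  exact not_isBackwardSingularPoint_of_near hr hfin (mem_ball.1 hy)

/-- **Regular on a closed shell ⇒ a QUIET SHELL** (the covering step of ROUND-26 §3a (S2)).  If `(0, y)` is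
not backward singular for ANY `y` of the closed shell `{R ≤ |y| ≤ A₀R}` (`R > 0`, `A₀ > 1`), then `U`
is essentially bounded on a shell slab `]−δ,0[ × {R' < |y| < A₀R'}` for some `δ, R' > 0` — the
quiet-shell clause `QA(U, A₀)` of line `annulus-dichotomy`, verbatim.  Proof: each shell point has a
bounded backward cylinder; finitely many cover the compact shell; a Lebesgue thickening of the shell lies
in their union, and it contains the open shell of the slightly smaller radius `R' = max(R − η/2, R/2)`
(radial projection onto the sphere `|y| = R`); `δ` = the least squared radius, `K` = the sum of the bounds.
[folklore] -/
theorem quietShell_of_forall_not_isBackwardSingularPoint {R A₀ : ℝ} (hR : 0 < R) (hA₀ : 1 < A₀)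
    (hreg : ∀ y : EuclideanSpace ℝ (Fin 3), R ≤ ‖y‖ → ‖y‖ ≤ A₀ * R →
      ¬ IsBackwardSingularPoint U ((0 : ℝ), y)) :
    ∃ δ : ℝ, 0 < δ ∧ ∃ R' : ℝ, 0 < R' ∧ ∃ K : ℝ,
      ∀ᵐ z ∂(volume.restrict
        (Ioo (-δ) 0 ×ˢ {y : EuclideanSpace ℝ (Fin 3) | R' < ‖y‖ ∧ ‖y‖ < A₀ * R'})),
          ‖U z.1 z.2‖ ≤ K := by
  classical
  set S : Set (EuclideanSpace ℝ (Fin 3)) := {y | R ≤ ‖y‖ ∧ ‖y‖ ≤ A₀ * R} with hS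
  -- a bounded backward cylinder at every shell point
  have hreg' : ∀ y ∈ S, ∃ r : ℝ, 0 < r ∧ eLpNorm (uncurry U) ∞
      (volume.restrict (parabolicCylinder r (((0 : ℝ), y) : ℝ × EuclideanSpace ℝ (Fin 3)))) ≠ ∞ := by
    intro y hy
    have h := hreg y hy.1 hy.2
    simp only [IsBackwardSingularPoint, not_forall] at h
    obtain ⟨r, hr, hfin⟩ := h
    exact ⟨r, hr, hfin⟩
  choose! r hr hfin using hreg'
  -- the shell is compact
  have hSc : IsCompact S := by
    refine (isCompact_closedBall (0 : EuclideanSpace ℝ (Fin 3)) (A₀ * R)).of_isClosed_subset ?_ ?_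
    · exact (isClosed_le continuous_const continuous_norm).inter
        (isClosed_le continuous_norm continuous_const)
    · intro y hy
      simpa [mem_closedBall, dist_zero_right] using hy.2
  -- finite subcover by the open balls `B(y, r y)`, indexed by the shell points
  obtain ⟨t, hcov⟩ : ∃ t : Finset S, S ⊆ ⋃ i ∈ t, ball (i : EuclideanSpace ℝ (Fin 3)) (r i) := by
    have hopen : ∀ i : S, IsOpen (ball (i : EuclideanSpace ℝ (Fin 3)) (r i)) := fun _ => isOpen_ball
    have hcover : S ⊆ ⋃ i : S, ball (i : EuclideanSpace ℝ (Fin 3)) (r i) :=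
      fun y hy => mem_iUnion.2 ⟨⟨y, hy⟩, mem_ball_self (hr y hy)⟩
    exact hSc.elim_finite_subcover _ hopen hcover
  -- the shell is non-empty (it contains a point of norm `R`), hence so is `t`
  obtain ⟨y₀, hy₀⟩ : ∃ y₀ : EuclideanSpace ℝ (Fin 3), ‖y₀‖ = R := exists_norm_eq _ hR.le
  have hy₀S : y₀ ∈ S := ⟨hy₀.ge, by rw [hy₀]; nlinarith⟩
  have htne : t.Nonempty := by
    obtain ⟨i, hi, -⟩ := mem_iUnion₂.1 (hcov hy₀S)
    exact ⟨i, hi⟩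
  -- a Lebesgue thickening of the shell inside the union of the balls
  set O : Set (EuclideanSpace ℝ (Fin 3)) := ⋃ i ∈ t, ball (i : EuclideanSpace ℝ (Fin 3)) (r i) with hO
  have hOo : IsOpen O := isOpen_biUnion fun _ _ => isOpen_ball
  obtain ⟨η, hη, hthick⟩ := hSc.exists_thickening_subset_open hOo hcov
  -- the data of the quiet shell
  set δ : ℝ := t.inf' htne (fun i => r i ^ 2) with hδ
  set R' : ℝ := max (R - η / 2) (R / 2) with hR'
  set K : ℝ := ∑ i ∈ t, (eLpNorm (uncurry U) ∞ (volume.restrict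
    (parabolicCylinder (r i) (((0 : ℝ), (i : EuclideanSpace ℝ (Fin 3))) : ℝ × EuclideanSpace ℝ (Fin 3))))).toReal
    with hK
  have hδpos : 0 < δ := by
    obtain ⟨i, hi, hieq⟩ := Finset.exists_mem_eq_inf' htne (fun i => r i ^ 2)
    rw [hδ, hieq]
    exact pow_pos (hr i i.2) 2
  have hR'pos : 0 < R' := lt_max_of_lt_right (half_pos hR)
  have hR'lt : R' < R := max_lt (by linarith) (by linarith)
  have hR'ge : R - η / 2 ≤ R' := le_max_left _ _
  refine ⟨δ, hδpos, R', hR'pos, K, ?_⟩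
  -- the shell slab lies in the union of the finitely many cylinders
  have hsub : Ioo (-δ) 0 ×ˢ {y : EuclideanSpace ℝ (Fin 3) | R' < ‖y‖ ∧ ‖y‖ < A₀ * R'} ⊆
      ⋃ i ∈ t, parabolicCylinder (r i)
        (((0 : ℝ), (i : EuclideanSpace ℝ (Fin 3))) : ℝ × EuclideanSpace ℝ (Fin 3)) := by
    rintro ⟨s, w⟩ ⟨hs, hw1, hw2⟩
    -- `w` lies in the thickening of the shell
    have hwO : w ∈ O := by
      apply hthick
      rw [mem_thickening_iff]
      by_cases hwR : R ≤ ‖w‖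
      · refine ⟨w, ⟨hwR, ?_⟩, by simpa using hη⟩
        have : A₀ * R' ≤ A₀ * R := mul_le_mul_of_nonneg_left hR'lt.le (by linarith)
        linarith
      · have hwR : ‖w‖ < R := not_le.1 hwR
        have hw0 : 0 < ‖w‖ := hR'pos.trans hw1
        have hwne : w ≠ 0 := norm_pos_iff.1 hw0
        -- radial projection of `w` onto the sphere of radius `R`
        refine ⟨(R / ‖w‖) • w, ⟨?_, ?_⟩, ?_⟩
        · rw [norm_smul, norm_div, Real.norm_of_nonneg hR.le, norm_norm, div_mul_cancel₀ _ hw0.ne']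
        · rw [norm_smul, norm_div, Real.norm_of_nonneg hR.le, norm_norm, div_mul_cancel₀ _ hw0.ne']
          nlinarith
        · rw [dist_eq_norm]
          have e : w - (R / ‖w‖) • w = (1 - R / ‖w‖) • w := by
            rw [sub_smul, one_smul]
          rw [e, norm_smul, Real.norm_eq_abs, abs_of_nonpos (by
            rw [sub_nonpos, le_div_iff₀ hw0, one_mul]; exact hwR.le)]
          have : -(1 - R / ‖w‖) * ‖w‖ = R - ‖w‖ := by field_simp; ring
          rw [this]
          linarith
    obtain ⟨i, hi, hwi⟩ := mem_iUnion₂.1 hwO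
    refine mem_iUnion₂.2 ⟨i, hi, ?_⟩
    rw [mem_parabolicCylinder]
    refine ⟨⟨?_, hs.2⟩, mem_ball.1 hwi⟩
    have hδle : δ ≤ r i ^ 2 := by
      rw [hδ]
      exact Finset.inf'_le _ hi
    simp only
    linarith [hs.1]
  refine ae_restrict_of_ae_restrict_of_subset hsub ?_
  rw [ae_restrict_biUnion_finset_iff]
  intro i hi
  have hfin_i := hfin i i.2
  have hKi : (eLpNorm (uncurry U) ∞ (volume.restrict (parabolicCylinder (r i)
      (((0 : ℝ), (i : EuclideanSpace ℝ (Fin 3))) : ℝ × EuclideanSpace ℝ (Fin 3))))).toReal ≤ K := by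
    rw [hK]
    exact Finset.single_le_sum (f := fun i : S => (eLpNorm (uncurry U) ∞ (volume.restrict
      (parabolicCylinder (r i)
        (((0 : ℝ), (i : EuclideanSpace ℝ (Fin 3))) : ℝ × EuclideanSpace ℝ (Fin 3))))).toReal)
      (fun _ _ => ENNReal.toReal_nonneg) hi
  filter_upwards [enorm_ae_le_eLpNormEssSup (uncurry U) (volume.restrict (parabolicCylinder (r i)
    (((0 : ℝ), (i : EuclideanSpace ℝ (Fin 3))) : ℝ × EuclideanSpace ℝ (Fin 3))))] with z hz
  rw [← eLpNorm_exponent_top] at hz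
  calc ‖U z.1 z.2‖ = ‖uncurry U z‖ₑ.toReal := (toReal_enorm _).symm
    _ ≤ (eLpNorm (uncurry U) ∞ (volume.restrict (parabolicCylinder (r i)
        (((0 : ℝ), (i : EuclideanSpace ℝ (Fin 3))) : ℝ × EuclideanSpace ℝ (Fin 3))))).toReal :=
      ENNReal.toReal_mono hfin_i hz
    _ ≤ K := hKi

end TopSingular

/-! ### §3 (S2) The loud dust is uniformly perfect: every thick shell around a top singular point meets `Σ₀` -/

section UniformlyPerfect

/-- **(S2) UNIFORM PERFECTNESS OF THE LOUD DUST** (ROUND-26 §3a).  Let `A₀ > 1` be a quiet-shell-excluding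
ratio for the class `(M, D₀, C)` — the hypothesis `hQA` of `stub_no_loudShellExtinctApex`, verbatim: every
extinct Type-I apex of the class with a quiet shell of ratio `A₀` is not backward singular at the origin.
If `(U, P, G)` carries the apex package of that class and `(0, x)` is backward singular, then for EVERY
`R > 0` the closed shell `{R ≤ |y − x| ≤ A₀R}` contains a point `y` with `(0, y)` backward singular.
Proof: otherwise every shell point is regular, the translate `U(·, · + x)` has a quiet shell of ratio `A₀`
(§2) and carries the package (§1), so `hQA` makes its origin — i.e. `(0, x)` for `U` — regular.
[folklore; Tao 2019 arXiv:1908.04958 §5 (shell of regularity)] -/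
theorem exists_topSingular_mem_shell_of_quietShellExclusion
    {M D₀ : ℝ≥0} {C A₀ : ℝ} (hA₀ : 1 < A₀)
    (hQA : ∀ (U : ℝ → EuclideanSpace ℝ (Fin 3) → EuclideanSpace ℝ (Fin 3))
      (P : ℝ → EuclideanSpace ℝ (Fin 3) → ℝ)
      (G : ℝ → EuclideanSpace ℝ (Fin 3) →
        EuclideanSpace ℝ (Fin 3) →L[ℝ] EuclideanSpace ℝ (Fin 3)),
      (∀ a : ℝ, 0 < a →
        IsSuitableWeakSolutionInBall a (0 : ℝ × EuclideanSpace ℝ (Fin 3)) U P) →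
      (∀ a : ℝ, 0 < a →
        HasWeakSpatialGradientOn
          (parabolicCylinderOpens a (0 : ℝ × EuclideanSpace ℝ (Fin 3))) U G) →
      (∀ a : ℝ, 0 < a →
        typeIBound (parabolicCylinder a (0 : ℝ × EuclideanSpace ℝ (Fin 3))) U P G ≤ M) →
      (∀ z₀ : ℝ × EuclideanSpace ℝ (Fin 3), z₀.1 ≤ 0 →
        ∀ r : ℝ, 0 < r → cknD r z₀ P ≤ D₀) →
      (∀ s : ℝ, s < 0 →
        ∀ᵐ y : EuclideanSpace ℝ (Fin 3), ‖U s y‖ ≤ C / Real.sqrt (-s)) →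
      (∀ φ : EuclideanSpace ℝ (Fin 3) → EuclideanSpace ℝ (Fin 3),
        ContDiff ℝ (⊤ : ℕ∞) φ →
        HasCompactSupport φ → ∀ ε : ℝ, 0 < ε →
        ∃ s₀ : ℝ, s₀ < 0 ∧ ∀ᵐ s ∂(volume.restrict (Ioo s₀ 0)), |∫ y, ⟪U s y, φ y⟫| ≤ ε) →
      (∃ δ : ℝ, 0 < δ ∧ ∃ R : ℝ, 0 < R ∧ ∃ K : ℝ,
        ∀ᵐ z ∂(volume.restrict
          (Ioo (-δ) 0 ×ˢ {y : EuclideanSpace ℝ (Fin 3) | R < ‖y‖ ∧ ‖y‖ < A₀ * R})),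
            ‖U z.1 z.2‖ ≤ K) →
      ¬ IsBackwardSingularPoint U (0 : ℝ × EuclideanSpace ℝ (Fin 3)))
    {U : ℝ → EuclideanSpace ℝ (Fin 3) → EuclideanSpace ℝ (Fin 3)}
    {P : ℝ → EuclideanSpace ℝ (Fin 3) → ℝ}
    {G : ℝ → EuclideanSpace ℝ (Fin 3) → EuclideanSpace ℝ (Fin 3) →L[ℝ] EuclideanSpace ℝ (Fin 3)}
    (hsw : ∀ a : ℝ, 0 < a →
      IsSuitableWeakSolutionInBall a (0 : ℝ × EuclideanSpace ℝ (Fin 3)) U P)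
    (hG : ∀ a : ℝ, 0 < a →
      HasWeakSpatialGradientOn
        (parabolicCylinderOpens a (0 : ℝ × EuclideanSpace ℝ (Fin 3))) U G)
    (hI : ∀ a : ℝ, 0 < a →
      typeIBound (parabolicCylinder a (0 : ℝ × EuclideanSpace ℝ (Fin 3))) U P G ≤ M)
    (hD : ∀ z₀ : ℝ × EuclideanSpace ℝ (Fin 3), z₀.1 ≤ 0 →
      ∀ r : ℝ, 0 < r → cknD r z₀ P ≤ D₀)
    (hrate : ∀ s : ℝ, s < 0 →
      ∀ᵐ y : EuclideanSpace ℝ (Fin 3), ‖U s y‖ ≤ C / Real.sqrt (-s))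
    (htop : ∀ φ : EuclideanSpace ℝ (Fin 3) → EuclideanSpace ℝ (Fin 3),
      ContDiff ℝ (⊤ : ℕ∞) φ →
      HasCompactSupport φ → ∀ ε : ℝ, 0 < ε →
      ∃ s₀ : ℝ, s₀ < 0 ∧ ∀ᵐ s ∂(volume.restrict (Ioo s₀ 0)), |∫ y, ⟪U s y, φ y⟫| ≤ ε)
    {x : EuclideanSpace ℝ (Fin 3)} (hx : IsBackwardSingularPoint U ((0 : ℝ), x))
    {R : ℝ} (hR : 0 < R) :
    ∃ y : EuclideanSpace ℝ (Fin 3), R ≤ ‖y - x‖ ∧ ‖y - x‖ ≤ A₀ * R ∧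
      IsBackwardSingularPoint U ((0 : ℝ), y) := by
  by_contra hno
  push Not at hno
  -- every point of the closed shell about the origin is regular for the translate
  have hreg : ∀ y : EuclideanSpace ℝ (Fin 3), R ≤ ‖y‖ → ‖y‖ ≤ A₀ * R →
      ¬ IsBackwardSingularPoint (fun s y => U s (y + x)) ((0 : ℝ), y) := by
    intro y h1 h2
    rw [isBackwardSingularPoint_translate_iff]
    have e : ‖y + x - x‖ = ‖y‖ := by rw [add_sub_cancel_right]
    exact hno (y + x) (by rw [e]; exact h1) (by rw [e]; exact h2)
  obtain ⟨hsw', hG', hI', hD', hrate', htop'⟩ := apexPackage_translate x hsw hG hI hD hrate htop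
  have hquiet := quietShell_of_forall_not_isBackwardSingularPoint hR hA₀ hreg
  have hreg0 := hQA _ _ _ hsw' hG' hI' hD' hrate' htop' hquiet
  exact hreg0 ((isBackwardSingularPoint_translate_zero_iff x U).2 hx)

/-- **The loud dust is unbounded** (ROUND-26 §3a (S2), `R → ∞`): under the same quiet-shell-exclusion
hypothesis, a backward-singular extinct Type-I apex of the class has top singular points of arbitrarily
large norm. [folklore] -/
theorem exists_topSingular_norm_ge_of_quietShellExclusion
    {M D₀ : ℝ≥0} {C A₀ : ℝ} (hA₀ : 1 < A₀)
    (hQA : ∀ (U : ℝ → EuclideanSpace ℝ (Fin 3) → EuclideanSpace ℝ (Fin 3))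
      (P : ℝ → EuclideanSpace ℝ (Fin 3) → ℝ)
      (G : ℝ → EuclideanSpace ℝ (Fin 3) →
        EuclideanSpace ℝ (Fin 3) →L[ℝ] EuclideanSpace ℝ (Fin 3)),
      (∀ a : ℝ, 0 < a →
        IsSuitableWeakSolutionInBall a (0 : ℝ × EuclideanSpace ℝ (Fin 3)) U P) →
      (∀ a : ℝ, 0 < a →
        HasWeakSpatialGradientOn
          (parabolicCylinderOpens a (0 : ℝ × EuclideanSpace ℝ (Fin 3))) U G) →
      (∀ a : ℝ, 0 < a →
        typeIBound (parabolicCylinder a (0 : ℝ × EuclideanSpace ℝ (Fin 3))) U P G ≤ M) →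
      (∀ z₀ : ℝ × EuclideanSpace ℝ (Fin 3), z₀.1 ≤ 0 →
        ∀ r : ℝ, 0 < r → cknD r z₀ P ≤ D₀) →
      (∀ s : ℝ, s < 0 →
        ∀ᵐ y : EuclideanSpace ℝ (Fin 3), ‖U s y‖ ≤ C / Real.sqrt (-s)) →
      (∀ φ : EuclideanSpace ℝ (Fin 3) → EuclideanSpace ℝ (Fin 3),
        ContDiff ℝ (⊤ : ℕ∞) φ →
        HasCompactSupport φ → ∀ ε : ℝ, 0 < ε →
        ∃ s₀ : ℝ, s₀ < 0 ∧ ∀ᵐ s ∂(volume.restrict (Ioo s₀ 0)), |∫ y, ⟪U s y, φ y⟫| ≤ ε) →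
      (∃ δ : ℝ, 0 < δ ∧ ∃ R : ℝ, 0 < R ∧ ∃ K : ℝ,
        ∀ᵐ z ∂(volume.restrict
          (Ioo (-δ) 0 ×ˢ {y : EuclideanSpace ℝ (Fin 3) | R < ‖y‖ ∧ ‖y‖ < A₀ * R})),
            ‖U z.1 z.2‖ ≤ K) →
      ¬ IsBackwardSingularPoint U (0 : ℝ × EuclideanSpace ℝ (Fin 3)))
    {U : ℝ → EuclideanSpace ℝ (Fin 3) → EuclideanSpace ℝ (Fin 3)}
    {P : ℝ → EuclideanSpace ℝ (Fin 3) → ℝ}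
    {G : ℝ → EuclideanSpace ℝ (Fin 3) → EuclideanSpace ℝ (Fin 3) →L[ℝ] EuclideanSpace ℝ (Fin 3)}
    (hsw : ∀ a : ℝ, 0 < a →
      IsSuitableWeakSolutionInBall a (0 : ℝ × EuclideanSpace ℝ (Fin 3)) U P)
    (hG : ∀ a : ℝ, 0 < a →
      HasWeakSpatialGradientOn
        (parabolicCylinderOpens a (0 : ℝ × EuclideanSpace ℝ (Fin 3))) U G)
    (hI : ∀ a : ℝ, 0 < a →
      typeIBound (parabolicCylinder a (0 : ℝ × EuclideanSpace ℝ (Fin 3))) U P G ≤ M)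
    (hD : ∀ z₀ : ℝ × EuclideanSpace ℝ (Fin 3), z₀.1 ≤ 0 →
      ∀ r : ℝ, 0 < r → cknD r z₀ P ≤ D₀)
    (hrate : ∀ s : ℝ, s < 0 →
      ∀ᵐ y : EuclideanSpace ℝ (Fin 3), ‖U s y‖ ≤ C / Real.sqrt (-s))
    (htop : ∀ φ : EuclideanSpace ℝ (Fin 3) → EuclideanSpace ℝ (Fin 3),
      ContDiff ℝ (⊤ : ℕ∞) φ →
      HasCompactSupport φ → ∀ ε : ℝ, 0 < ε →
      ∃ s₀ : ℝ, s₀ < 0 ∧ ∀ᵐ s ∂(volume.restrict (Ioo s₀ 0)), |∫ y, ⟪U s y, φ y⟫| ≤ ε)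
    (hsing : IsBackwardSingularPoint U (0 : ℝ × EuclideanSpace ℝ (Fin 3)))
    (ρ : ℝ) :
    ∃ y : EuclideanSpace ℝ (Fin 3), ρ ≤ ‖y‖ ∧ IsBackwardSingularPoint U ((0 : ℝ), y) := by
  have hx : IsBackwardSingularPoint U ((0 : ℝ), (0 : EuclideanSpace ℝ (Fin 3))) := hsing
  obtain ⟨y, hy1, -, hy3⟩ := exists_topSingular_mem_shell_of_quietShellExclusion hA₀ hQA hsw hG hI hD
    hrate htop hx (R := max ρ 1) (lt_max_of_lt_right one_pos)
  refine ⟨y, ?_, hy3⟩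
  rw [sub_zero] at hy1
  exact (le_max_left ρ 1).trans hy1

end UniformlyPerfect

end Summit.NavierStokesRegularity.NavierStokesRegularity.Theorems.TypeITraceScarL3

end
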